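import Mathlib
import Literature.Analysis.FluidPDE.CompressibleEulerImplosionOriginGermWindow2
import Summits.AtomisticToContinuum.HydrodynamicLimit.Theorems.ImplosionDichotomyDenseExcursionSonicPinnedProfileWindow2

/-!
# The pinned BCG profile IS the centre series on the core (crux `DenseExcursion`, line `sonic-cavity-renewal`,
# brick `exists_pinnedProfile_centre` of stub `stub_boxPackage`)

Helper file (`--supports stmt-AtomisticToContinuum-12586`) for the registered stub `stub_boxPackage` of the line
`sonic-cavity-renewal` (crux `Summit.AtomisticToContinuum.HydrodynamicLimit.Theses.ImplosionDichotomy.DenseExcursion`).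
Re-run of `exists_pinnedProfile_window2` (`…SonicPinnedProfileWindow2`, p157124) which, in addition to all its clauses,
EXPOSES THE SONIC SCALE `c = e^{T₀}` (`T₀` the sonic time of the `P₀` orbit in the `A = 1` origin normalisation) and
IDENTIFIES THE PROFILE WITH THE CENTRE SERIES: on the part `c·eˣ < 17/50` of the core the profile `(W, S)` equals the
series profile `(OriginSeries.CentreW2.Wser r c, OriginSeries.CentreW2.Sser r c)` of the certified centre expansion
(`Literature…CentreExpansionWindow2`, `centre_expansion_certified`), and `c ≥ 17/50` (the `P₀` germ has `D_Z < 0` on the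
certified disc `e^ξ ≤ 17/50`, `Literature…OriginGermWindow2`, while the orbit has `D_Z > 0` past its sonic time; the
orbit equals the germ there by uniqueness against the implicit system, `orbit_eq_germ_window2`).

* `Wser_eq_profile`, `exp_mul_Sser_eq_profile` — the even/odd resummations `W = −(𝒲(ζ) − 𝒲(−ζ))/(2ζ)`,
  `eˣS = (𝒲(ζ) + 𝒲(−ζ))/(6c)` of the series profile (`ζ = c eˣ`);
* `exists_pinnedProfile_centre` (registered) — the witness with `17/50 ≤ c` and `W = Wser r c`, `S = Sser r c` on `c eˣ < 17/50`.

With `centre_expansion_certified` this yields clause (d) of `CavityTube` on `x ≤ −1/3` for the witness as soon as the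
upper bound `c ≤ 10/21` (`T₀ ≤ log(10/21)`; measured `c ∈ [0.4281, 0.4332]`) is certified — the one remaining datum.

Sources: Buckmaster–Cao-Labora–Gómez-Serrano 2025, Thm 1.1, Prop. 2.5, Props. 2.2–2.3, Prop. 1.6, §6.
-/

noncomputable section

open Set Filter Metric Topology
open scoped ContDiff

namespace Summit.AtomisticToContinuum.HydrodynamicLimit.Theorems.SonicCavityRenewal

open Literature.MathematicalPhysics.KineticTheory (V3)
open Literature.Analysis.FluidPDE.BuckmasterCaolaboraGomezserrano2025
open Literature.Analysis.FluidPDE.BuckmasterCaolaboraGomezserrano2025.OriginSeries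
open Literature.Analysis.FluidPDE.BuckmasterCaolaboraGomezserrano2025.OriginSeries.CentreW2
open Literature.Analysis.FluidPDE.BuckmasterCaolaboraGomezserrano2025.Monatomic
open Literature.Analysis.FluidPDE.BuckmasterCaolaboraGomezserrano2025.Monatomic.Germ
open Literature.Analysis.FluidPDE.BuckmasterCaolaboraGomezserrano2025.Monatomic.SonicSeries
open Summit.AtomisticToContinuum.HydrodynamicLimit.Theorems.R2OneModeTwoConditions
open Summit.AtomisticToContinuum.HydrodynamicLimit.Theorems.KidderKnobMelnikov
  (differentiableAt_of_radialScalar differentiableAt_of_radialField)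

/-! ## The resummations of the series profile -/

/-- **`W = −(𝒲(ζ) − 𝒲(−ζ))/(2ζ)`**: the series velocity profile is the odd part of the centre series (`ζ = c eˣ` inside the
certified disc). [cite: BuckmasterCaolaboraGomezserrano2025, Prop. 2.5] -/
theorem Wser_eq_profile {r c : ℝ} (hr : r ∈ Set.Icc ((13890041/12500000 : ℚ) : ℝ) ((697/625 : ℚ) : ℝ)) (hc : 0 < c) {x : ℝ}
    (hx : (73 / 25 : ℝ) * (c * Real.exp x) < 1) :
    Wser r c x = -(profile r 1 (c * Real.exp x) - profile r 1 (-(c * Real.exp x))) / (2 * (c * Real.exp x)) := by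
  set ζ : ℝ := c * Real.exp x with hζ
  have hζ0 : 0 < ζ := by positivity
  have hμ : (0 : ℝ) < 73 / 25 := by norm_num
  have hKw := abs_w_le_one_mul_pow hr
  have hζa : (73 / 25 : ℝ) * |ζ| < 1 := by rwa [abs_of_pos hζ0]
  have hζb : (73 / 25 : ℝ) * |(-ζ)| < 1 := by rwa [abs_neg]
  have hP := hasSum_profile_of_bound hμ hKw hζa
  have hN := hasSum_profile_of_bound hμ hKw hζb
  set g : ℕ → ℝ := fun k => w r 1 k * (ζ ^ k - (-ζ) ^ k) with hg
  have hD : HasSum g (profile r 1 ζ - profile r 1 (-ζ)) := by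
    refine (hP.sub hN).congr_fun fun k => ?_
    simp only [hg]; ring
  have hW : HasSum (fun j => aW r j * (c * Real.exp x) ^ j) (Wser r c x) := hasSum_xSeries (aW_bound hr) hμ hc hx
  -- `g (j+1) = (-2ζ)·(a_j ζ^j)`
  have hshift : HasSum (fun j => g (j + 1)) (-(2 * ζ) * Wser r c x) := by
    refine (hW.mul_left (-(2 * ζ))).congr_fun fun j => ?_
    simp only [hg]
    unfold aW
    by_cases hj : j % 2 = 0
    · have ho : Odd (j + 1) := Nat.odd_iff.mpr (by omega)
      rw [if_pos hj, ho.neg_pow, hζ]; ring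
    · have he : Even (j + 1) := Nat.even_iff.mpr (by omega)
      rw [if_neg hj, he.neg_pow]; ring
  have hD' := (hasSum_nat_add_iff' 1).mpr hD
  have hg0 : ∑ i ∈ Finset.range 1, g i = 0 := by simp [hg]
  rw [hg0, sub_zero] at hD'
  have key : profile r 1 ζ - profile r 1 (-ζ) = -(2 * ζ) * Wser r c x := hD'.unique hshift
  rw [key]
  field_simp

/-- **`eˣ S = (𝒲(ζ) + 𝒲(−ζ))/(6c)`**: the series sound speed is the even part of the centre series.
[cite: BuckmasterCaolaboraGomezserrano2025, Prop. 2.5] -/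
theorem exp_mul_Sser_eq_profile {r c : ℝ} (hr : r ∈ Set.Icc ((13890041/12500000 : ℚ) : ℝ) ((697/625 : ℚ) : ℝ)) (hc : 0 < c)
    {x : ℝ} (hx : (73 / 25 : ℝ) * (c * Real.exp x) < 1) :
    Real.exp x * Sser r c x = (profile r 1 (c * Real.exp x) + profile r 1 (-(c * Real.exp x))) / (6 * c) := by
  set ζ : ℝ := c * Real.exp x with hζ
  have hζ0 : 0 < ζ := by positivity
  have hμ : (0 : ℝ) < 73 / 25 := by norm_num
  have hKw := abs_w_le_one_mul_pow hr
  have hζa : (73 / 25 : ℝ) * |ζ| < 1 := by rwa [abs_of_pos hζ0]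
  have hζb : (73 / 25 : ℝ) * |(-ζ)| < 1 := by rwa [abs_neg]
  have hP := hasSum_profile_of_bound hμ hKw hζa
  have hN := hasSum_profile_of_bound hμ hKw hζb
  set g : ℕ → ℝ := fun k => w r 1 k * (ζ ^ k + (-ζ) ^ k) with hg
  have hD : HasSum g (profile r 1 ζ + profile r 1 (-ζ)) := by
    refine (hP.add hN).congr_fun fun k => ?_
    simp only [hg]; ring
  have hS : HasSum (fun j => aS r c j * (c * Real.exp x) ^ j) (xSeries (aS r c) c x) := hasSum_xSeries (aS_bound hr hc) hμ hc hx
  have hsame : HasSum g (6 * c * xSeries (aS r c) c x) := by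
    refine (hS.mul_left (6 * c)).congr_fun fun j => ?_
    simp only [hg]
    unfold aS
    by_cases hj : j % 2 = 0
    · have he : Even j := Nat.even_iff.mpr hj
      rw [if_pos hj, he.neg_pow, hζ]; field_simp; ring
    · have ho : Odd j := Nat.odd_iff.mpr (by omega)
      rw [if_neg hj, ho.neg_pow]; ring
  have key : profile r 1 ζ + profile r 1 (-ζ) = 6 * c * xSeries (aS r c) c x := hD.unique hsame
  rw [show Real.exp x * Sser r c x = (fun y => Real.exp y * Sser r c y) x from rfl, exp_mul_Sser, key]
  field_simp

/-! ## The witness with its sonic scale and the series identification -/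

/-- **Brick `exists_pinnedProfile_centre` of stub `stub_boxPackage` (line `sonic-cavity-renewal`): THE PINNED PROFILE IS THE
CENTRE SERIES ON THE CORE.** There are a speed `r` in the shooting window `[13890041/12500000, 697/625]`, a sonic scale
`c ≥ 17/50` and a profile `(W, S)` with all the clauses of `exists_pinnedProfile_window2` (`IsMonatomicProfile`,
`OrigProfileEqs`, sonic point at `0` with the exact repulsivity and sonic value, analyticity at the sonic point) such that
`W = Wser r c` and `S = Sser r c` wherever `c·eˣ < 17/50`. [cite: BuckmasterCaolaboraGomezserrano2025, Thm 1.1, Prop. 2.5, Props. 2.2–2.3, §6] -/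
theorem exists_pinnedProfile_centre : ∃ (r c : ℝ) (W S : ℝ → ℝ), ((13890041 / 12500000 : ℝ) ≤ r ∧ r ≤ 697 / 625) ∧ IsMonatomicProfile r W S ∧ OrigProfileEqs r W S ∧ W 0 + S 0 = 1 ∧ (∀ x, x < 0 → 1 < W x + S x) ∧ (∀ x, 0 < x → W x + S x < 1) ∧ deriv W 0 + deriv S 0 = -(2 - r - Real.sqrt (2 * (r - 1))) ∧ deriv W 0 + deriv S 0 ≤ -(2 / 5) ∧ W 0 = (r - Real.sqrt (r ^ 2 - 6 * r + 6)) / 2 ∧ AnalyticAt ℝ W 0 ∧ AnalyticAt ℝ S 0 ∧ 17 / 50 ≤ c ∧ ∀ x, c * Real.exp x < 17 / 50 → W x = OriginSeries.CentreW2.Wser r c x ∧ S x = OriginSeries.CentreW2.Sser r c x := by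
  obtain ⟨r, hr, Wo, Zo, T₀, hWo, hZo, heqo, hWZo, hlWo, hlZo, ⟨ε, hε, horigino⟩, hbWo, hbZo, hnego, hposo⟩ :=
    exists_meetingWZ_window2
  have hrQ : r ∈ Set.Icc ((13890041/12500000 : ℚ) : ℝ) ((697/625 : ℚ) : ℝ) := by
    refine ⟨?_, ?_⟩ <;> push_cast <;> linarith [hr.1, hr.2]
  -- the orbit is the `P₀` germ on the certified disc
  have hWod : Differentiable ℝ Wo := hWo.differentiable (by simp)
  have hZod : Differentiable ℝ Zo := hZo.differentiable (by simp)
  have hgerm := orbit_eq_germ_window2 hrQ hWod hZod heqo hε horigino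
  -- the sonic scale `c = e^{T₀} ≥ 17/50`
  set c : ℝ := Real.exp T₀ with hc
  have hc0 : 0 < c := Real.exp_pos _
  have hclb : 17 / 50 ≤ c := by
    refine le_of_not_gt fun hlt => ?_
    have hT : T₀ < Real.log (17 / 50) := by rw [Real.lt_log_iff_exp_lt (by norm_num)]; exact hlt
    set ξ₁ : ℝ := (T₀ + Real.log (17 / 50)) / 2 with hξ₁
    have h1 : T₀ < ξ₁ := by rw [hξ₁]; linarith
    have h2 : Real.exp ξ₁ < 17 / 50 := by
      rw [← Real.lt_log_iff_exp_lt (by norm_num), hξ₁]; linarith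
    have hg := hgerm ξ₁ h2
    have hs := (germ_signs_window2 hrQ h2.le).2
    rw [← hg] at hs
    have hp := hposo ξ₁ h1
    simp only at hs
    linarith
  -- the shifted orbit (adapted from `exists_sonicWZ_window2`)
  have hprof := originProfile_analytic (r := r) one_pos
  have hshift : Tendsto (fun x : ℝ => x + T₀) (𝓝 0) (𝓝 T₀) := by
    have h := (tendsto_id (x := 𝓝 (0 : ℝ))).add_const T₀
    simpa using h
  set Wc : ℝ → ℝ := fun x => Wo (x + T₀) with hWc
  set Zc : ℝ → ℝ := fun x => Zo (x + T₀) with hZc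
  have hW : ContDiff ℝ ∞ Wc := hWo.comp (contDiff_id.add contDiff_const)
  have hZ : ContDiff ℝ ∞ Zc := hZo.comp (contDiff_id.add contDiff_const)
  have heq : ∀ ξ, DW (Wc ξ) (Zc ξ) * deriv Wc ξ = NW r (Wc ξ) (Zc ξ) ∧ DZ (Wc ξ) (Zc ξ) * deriv Zc ξ = NZ r (Wc ξ) (Zc ξ) := by
    intro ξ
    simp only [hWc, hZc]
    rw [deriv_comp_add_const, deriv_comp_add_const]; exact heqo _
  have hWZ : ∀ ξ, Zc ξ < Wc ξ := fun ξ => hWZo _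
  have hlW : Tendsto Wc atTop (𝓝 0) := hlWo.comp (tendsto_atTop_add_const_right _ T₀ tendsto_id)
  have hlZ : Tendsto Zc atTop (𝓝 0) := hlZo.comp (tendsto_atTop_add_const_right _ T₀ tendsto_id)
  set g : ℝ → ℝ := fun ζ => c⁻¹ * OriginSeries.profile r 1 (c * ζ) with hgdef
  have hg : AnalyticAt ℝ g 0 := by
    refine analyticAt_const.mul (hprof.1.comp_of_eq ?_ (by simp))
    exact analyticAt_const.mul analyticAt_id
  have hg0 : 0 < g 0 := by simp only [hgdef, mul_zero, hprof.2]; positivity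
  have horigin : ∀ ζ ∈ Ioo 0 (c⁻¹ * ε), ζ * Wc (Real.log ζ) = g ζ ∧ -ζ * Zc (Real.log ζ) = g (-ζ) := by
    intro ζ hζ
    obtain ⟨hζ0, hζε⟩ := hζ
    have hcζ : c * ζ ∈ Ioo 0 ε := ⟨by positivity, by rwa [lt_inv_mul_iff₀ hc0] at hζε⟩
    obtain ⟨h1, h2⟩ := horigino (c * ζ) hcζ
    have hlog : Real.log ζ + T₀ = Real.log (c * ζ) := by
      rw [Real.log_mul hc0.ne' hζ0.ne', hc, Real.log_exp]; ring
    simp only [hWc, hZc, hgdef]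
    rw [hlog, show c * -ζ = -(c * ζ) by ring, ← h1, ← h2]
    constructor <;> field_simp
  have hbW : Wc =ᶠ[𝓝 0] Wloc r := by
    have h := hbWo.comp_tendsto hshift
    refine h.trans (Eventually.of_forall fun x => ?_)
    simp
  have hbZ : Zc =ᶠ[𝓝 0] Zloc r := by
    have h := hbZo.comp_tendsto hshift
    refine h.trans (Eventually.of_forall fun x => ?_)
    simp
  have hneg : ∀ ξ, ξ < 0 → DZ (Wc ξ) (Zc ξ) < 0 := fun ξ hξ => hnego _ (by linarith)
  have hpos : ∀ ξ, 0 < ξ → 0 < DZ (Wc ξ) (Zc ξ) := fun ξ hξ => hposo _ (by linarith)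
  -- the profile (adapted from `exists_pinnedProfile_window2`)
  have hr₃ : 1.10102 < r := by norm_num at hr ⊢; linarith [hr.1]
  have hr₄ : r < 1.13476 := by norm_num at hr ⊢; linarith [hr.2]
  have hrκ : r ≤ 279 / 250 := by norm_num at hr ⊢; linarith [hr.2]
  have h3 : r3 < r := lt_of_lt_of_le (by have := ShootingL.r3_lt_rlo; rwa [ShootingL.rlo_eq] at this) hr.1
  have h4 : r < r4 := lt_of_le_of_lt hr.2 (by have := ShootingM.rhi_lt_r4; rwa [ShootingM.rhi_eq] at this)
  obtain ⟨U, S, hU3, hS3, hode, hSpos, hUinf, hSinf, hdict⟩ :=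
    profileData_of_WZ hW hZ heq hWZ hlW hlZ hg hg0 (by positivity : 0 < c⁻¹ * ε) horigin
  have hWf : wOf U = fun x => -(Wc x + Zc x) / 2 := funext fun x => (hdict x).1
  have hSf : sOf S = fun x => (Wc x - Zc x) / 6 := funext fun x => (hdict x).2
  have hsum : ∀ x, wOf U x + sOf S x = 1 - DZ (Wc x) (Zc x) := fun x => by
    rw [(hdict x).1, (hdict x).2]; unfold DZ; ring
  obtain ⟨hW0, hZ0, hW1, hZ1, hspec⟩ := sonicSeries_spec' h3 h4
  have hρ : |(0 : ℝ)| < sonicRad r := by rw [abs_zero]; exact sonicRad_pos (h4.trans r3_r4_mem.2.2)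
  obtain ⟨hanW, hanZ, -, -⟩ := hspec 0 hρ
  have hWc0 : Wc 0 = W0 r := by rw [hbW.eq_of_nhds, hW0]
  have hZc0 : Zc 0 = Z0 r := by rw [hbZ.eq_of_nhds, hZ0]
  have hdWc : deriv Wc 0 = W1 r := by rw [hbW.deriv_eq, hW1]
  have hdZc : deriv Zc 0 = Z1 r := by rw [hbZ.deriv_eq, hZ1]
  have hWd : Differentiable ℝ Wc := hW.differentiable (by simp)
  have hZd : Differentiable ℝ Zc := hZ.differentiable (by simp)
  have hκ' : deriv (wOf U) 0 + deriv (sOf S) 0 = -(2 - r - Real.sqrt (2 * (r - 1))) := by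
    have hdW : deriv (wOf U) 0 = -(deriv Wc 0 + deriv Zc 0) / 2 := by
      rw [hWf]
      exact (((hWd 0).hasDerivAt.add (hZd 0).hasDerivAt).neg.div_const 2).deriv
    have hdS : deriv (sOf S) 0 = (deriv Wc 0 - deriv Zc 0) / 6 := by
      rw [hSf]
      exact (((hWd 0).hasDerivAt.sub (hZd 0).hasDerivAt).div_const 6).deriv
    rw [hdW, hdS, hdWc, hdZc]
    unfold W1 Z1 Monatomic.p
    ring
  refine ⟨r, c, wOf U, sOf S, hr, isMonatomicProfile_wOf_sOf hr₃ hr₄ hU3 hS3 hode hSpos hUinf hSinf, fun x => ?_, ?_,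
    fun x hx => ?_, fun x hx => ?_, hκ', ?_, ?_, ?_, ?_, hclb, fun x hx => ?_⟩
  · -- the equations in original form
    have hζ : 0 < Real.exp x := Real.exp_pos x
    obtain ⟨h1, h2⟩ := hode (Real.exp x) hζ
    exact origProfileEqs_of_bcg (differentiableAt_of_radialField hU3 hζ) (differentiableAt_of_radialScalar hS3 hζ) h1 h2
  · -- `W 0 + S 0 = 1`
    rw [hsum, hWc0, hZc0, DZ_Ps]; ring
  · -- `x < 0`: `D_Z < 0`
    rw [hsum]; linarith [hneg x hx]
  · -- `x > 0`: `D_Z > 0`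
    rw [hsum]; linarith [hpos x hx]
  · -- `κ(r) ≥ 2/5` on the narrowed window
    rw [hκ']
    linarith [kappa_ge_two_fifths hrκ]
  · -- the sonic value `W(0) = (r - q)/2`
    rw [(hdict 0).1, hWc0, hZc0]
    unfold W0 Z0 Monatomic.q disc
    ring
  · -- analyticity at the sonic point
    rw [hWf]
    exact ((hanW.congr hbW.symm).add (hanZ.congr hbZ.symm)).neg.div_const
  · rw [hSf]
    exact ((hanW.congr hbW.symm).sub (hanZ.congr hbZ.symm)).div_const
  · -- the identification with the centre series on `c e^x < 17/50`
    have hexp : Real.exp (x + T₀) = c * Real.exp x := by rw [Real.exp_add, hc]; ring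
    have hlt : Real.exp (x + T₀) < 17 / 50 := by rw [hexp]; exact hx
    have hg' := hgerm (x + T₀) hlt
    have hWx : Wc x = (germ r (x + T₀)).1 := by simp only [hWc]; rw [← hg']
    have hZx : Zc x = (germ r (x + T₀)).2 := by simp only [hZc]; rw [← hg']
    rw [germ_fst] at hWx
    rw [germ_snd] at hZx
    have hE : Real.exp (-(x + T₀)) = (c * Real.exp x)⁻¹ := by rw [Real.exp_neg, hexp]
    rw [hE, hexp] at hWx hZx
    have hμx : (73 / 25 : ℝ) * (c * Real.exp x) < 1 := by nlinarith [Real.exp_pos x]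
    have hζ0 : 0 < c * Real.exp x := by positivity
    constructor
    · rw [(hdict x).1, Wser_eq_profile hrQ hc0 hμx, hWx, hZx]
      field_simp
      ring
    · rw [(hdict x).2]
      have hS := exp_mul_Sser_eq_profile hrQ hc0 hμx
      have hex : Real.exp x ≠ 0 := (Real.exp_pos x).ne'
      have : Sser r c x = (profile r 1 (c * Real.exp x) + profile r 1 (-(c * Real.exp x))) / (6 * c) / Real.exp x := by
        rw [← hS]; field_simp
      rw [this, hWx, hZx]
      field_simp
      ring

end Summit.AtomisticToContinuum.HydrodynamicLimit.Theorems.SonicCavityRenewal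

end
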